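import Mathlib
import Literature.NumberTheory.LFunctions.Zhang2022.Section13E1ZeroSumReduction
import HarnessLib

/-!
# Zhang (2022) §13 p. 75, (13.11): `𝓔` split into its seven discrete means and bounded, term by term,
# by "Cauchy's inequality" in terms of eight quadratic zero-sums — the assembler's interface

Topic `Literature/NumberTheory/LFunctions/Zhang2022` (Landau–Siegel audit tree; verdict-neutral).
Y. Zhang, *Discrete mean estimates and the Landau–Siegel zero*, arXiv:2211.02515v1 (2022)
[Zhang2022LandauSiegel], §13 p. 75, the display after (13.10) (`𝓔 = ΣΣ E₁*(ρ,ψ)|B(ρ,ψ)|ω(ρ)`, with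
`E₁*` the display after (13.3)) and (13.11) ("Combining (2.34), Cauchy's inequality, Proposition 7.1,
Lemma 5.9, 6.1 and 3.3, we can verify that `𝓔 = o(𝔓)`" — NOT carried out in print, GAP-LEDGER G-L3t6-3).
Lane ZHANG-L WP14, leaf `Skeleton.Eq1311Rel c′ c₀` (owner zl-w14-p5), frame of record CL-10 (W14-R2):
**an unrefereed manuscript under adjudication; nothing here asserts its Theorems 1–2.**

With the non-negative weight `w(ρ,ψ) = |L(ρ+β₁,ψ)/L′(ρ,ψ)|·|ω(ρ)|` and the abbreviations
`L_j = L(ρ+β_j,ψ)`, `N_j = N(ρ+β_j,ψ)`, `B = B(ρ,ψ)`, `E_j = E₁main(ρ+β_j,ψ)`, `ε′ = e^{−c₀𝓛¹⁰}`, the banked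
`Skeleton.frakE c′ c₀ χ` EQUALS (`frakE_eq_seven`)
`t₀⁻¹Σw|L₂L₃||B| + 𝓛⁻¹²³Σw|L₂||N₃B| + Σw|L₂||B|E₃ + ε′Σw|L₂||B| + 𝓛⁻¹²³Σw|N₃||N₂B| + Σw|N₃||B|E₂ + ε′Σw|N₃||B|`
— each summand a product `w·a·b` with the `L`-factor ALONE as `a` and `B×(short factor)` as `b` (the
pairing under which every mean square but one is of length `≤ P`, hence loss-free by Lemma 3.3 (i)).
`frakE_le_of_zeroSum_bounds` then bounds `𝓔` by Cauchy's inequality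
(`weighted_cauchy_schwarz`) and the `E₁`-reduction (`weighted_sum_E1main_le`) in terms of upper bounds
for the eight quadratic zero-sums `Q(F) = ΣΣ w|F(ρ,ψ)|²`, `F ∈ {L₂L₃, B, L₂, N₃B, N₃, N₂B, D₃ᵥB, D₂ᵥB}`
(`D_jᵥ = Σ_{n<T³}ψ(n)n^{−(ρ+β_j+iv)}`, uniformly in `|v| ≤ 𝓛²⁰`):
`𝓔 ≤ t₀⁻¹√Q₂₃√Q_B + 𝓛⁻¹²³(√Q_{L₂}√Q_{N₃B} + √Q_{N₃}√Q_{N₂B}) + 𝓛⁻⁶⁸·2√π𝓛¹⁵(√Q_{L₂}√Q_{D₃B} + √Q_{N₃}√Q_{D₂B})`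
`+ ε′(√Q_{L₂} + √Q_{N₃})√Q_B`. Purely algebraic (every `D`, `χ`, `c′`, `c₀`); the zero-sum bounds themselves
(p6's conversion `zeroSum_dirPoly_sq_le_of_prop22` / `zeroSum_weight_le_of_prop22` + the lane's mean
squares) are supplied by the closing file. No definitions, no new facts.

## References

* Y. Zhang, arXiv:2211.02515v1 (2022), §13 (13.3)–(13.11) p. 75. [cite: Zhang2022LandauSiegel, §13 (13.11) p.75]
-/

noncomputable section

open Complex Real Finset

namespace Literature.NumberTheory.LFunctions.Zhang2022.Typed.Section13

open Skeleton

variable (c' c₀ : ℝ) {D : ℕ} (χ : DirichletCharacter ℂ D)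

/-- **`𝓔` as seven discrete means** (display after (13.10) with `E₁*` expanded, display after (13.3)):
with `w = |L₁/L′||ω|` per zero, `𝓔 = t₀⁻¹Σw|L₂L₃||B| + 𝓛⁻¹²³Σw|L₂||N₃B| + Σw|L₂||B|E₁(ρ+β₃) +
e^{−c₀𝓛¹⁰}Σw|L₂||B| + 𝓛⁻¹²³Σw|N₃||N₂B| + Σw|N₃||B|E₁(ρ+β₂) + e^{−c₀𝓛¹⁰}Σw|N₃||B|`.
[cite: Zhang2022LandauSiegel, §13 (13.3), (13.7) p.75] -/
theorem frakE_eq_seven :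
    frakE c' c₀ χ =
      (t0 D)⁻¹ * (∑ i ∈ idx χ, (‖i.1.ψ.LFunction (i.2 + beta1 c' D) / deriv i.1.ψ.LFunction i.2‖ *
          ‖omegaW D i.2‖) * (‖i.1.ψ.LFunction (i.2 + beta2 c' D) * i.1.ψ.LFunction (i.2 + beta3 c' D)‖) *
          ‖Bpoly χ i.1 i.2‖) +
      (ell D ^ 123)⁻¹ * (∑ i ∈ idx χ, (‖i.1.ψ.LFunction (i.2 + beta1 c' D) / deriv i.1.ψ.LFunction i.2‖ *
          ‖omegaW D i.2‖) * ‖i.1.ψ.LFunction (i.2 + beta2 c' D)‖ *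
          ‖Nchar D (psiFn i.1) (i.2 + beta3 c' D) * Bpoly χ i.1 i.2‖) +
      (∑ i ∈ idx χ, (‖i.1.ψ.LFunction (i.2 + beta1 c' D) / deriv i.1.ψ.LFunction i.2‖ *
          ‖omegaW D i.2‖) * ‖i.1.ψ.LFunction (i.2 + beta2 c' D)‖ * ‖Bpoly χ i.1 i.2‖ *
          E1main i.1 (i.2 + beta3 c' D)) +
      Real.exp (-c₀ * ell D ^ 10) * (∑ i ∈ idx χ, (‖i.1.ψ.LFunction (i.2 + beta1 c' D) /
          deriv i.1.ψ.LFunction i.2‖ * ‖omegaW D i.2‖) * ‖i.1.ψ.LFunction (i.2 + beta2 c' D)‖ *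
          ‖Bpoly χ i.1 i.2‖) +
      (ell D ^ 123)⁻¹ * (∑ i ∈ idx χ, (‖i.1.ψ.LFunction (i.2 + beta1 c' D) / deriv i.1.ψ.LFunction i.2‖ *
          ‖omegaW D i.2‖) * ‖Nchar D (psiFn i.1) (i.2 + beta3 c' D)‖ *
          ‖Nchar D (psiFn i.1) (i.2 + beta2 c' D) * Bpoly χ i.1 i.2‖) +
      (∑ i ∈ idx χ, (‖i.1.ψ.LFunction (i.2 + beta1 c' D) / deriv i.1.ψ.LFunction i.2‖ *
          ‖omegaW D i.2‖) * ‖Nchar D (psiFn i.1) (i.2 + beta3 c' D)‖ * ‖Bpoly χ i.1 i.2‖ *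
          E1main i.1 (i.2 + beta2 c' D)) +
      Real.exp (-c₀ * ell D ^ 10) * (∑ i ∈ idx χ, (‖i.1.ψ.LFunction (i.2 + beta1 c' D) /
          deriv i.1.ψ.LFunction i.2‖ * ‖omegaW D i.2‖) * ‖Nchar D (psiFn i.1) (i.2 + beta3 c' D)‖ *
          ‖Bpoly χ i.1 i.2‖) := by
  simp only [frakE, E1star, E1full, Finset.mul_sum, ← Finset.sum_add_distrib]
  refine Finset.sum_congr rfl fun i _ => ?_
  simp only [norm_mul, norm_div]
  ring

/-- **`𝓔` bounded by Cauchy's inequality in terms of eight quadratic zero-sums** (the assembler's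
interface for (13.11), frame CL-10: the `L`-factor alone against `B×(short factor)`): if, with
`w = |L(ρ+β₁)/L′(ρ)||ω(ρ)|` and sums over `ψ ∈ Ψ₁`, `ρ ∈ 𝔷(ψ)`,
`ΣΣw|L₂L₃|² ≤ Q₂₃`, `ΣΣw|B|² ≤ Q_B`, `ΣΣw|L₂|² ≤ Q_{L₂}`, `ΣΣw|N₃B|² ≤ Q_{N₃B}`, `ΣΣw|N₃|² ≤ Q_{N₃}`,
`ΣΣw|N₂B|² ≤ Q_{N₂B}` and, for all `|v| ≤ 𝓛²⁰`, `ΣΣw|D₃(ρ+β₃+iv)B|² ≤ Q_{D₃}`, `ΣΣw|D₃(ρ+β₂+iv)B|² ≤ Q_{D₂}`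
(`D₃(w) = Σ_{n<T³}ψ(n)n^{−w}`), then
`𝓔 ≤ t₀⁻¹√Q₂₃√Q_B + 𝓛⁻¹²³(√Q_{L₂}√Q_{N₃B} + √Q_{N₃}√Q_{N₂B}) + 𝓛⁻⁶⁸(2√π𝓛¹⁵)(√Q_{L₂}√Q_{D₃} + √Q_{N₃}√Q_{D₂})`
`+ e^{−c₀𝓛¹⁰}(√Q_{L₂}√Q_B + √Q_{N₃}√Q_B)` (for `𝓛 > 0`). [cite: Zhang2022LandauSiegel, §13 (13.11) p.75] -/
theorem frakE_le_of_zeroSum_bounds (hℓ : 0 < ell D) {Q23 QB QL2 QN3B QN3 QN2B QD3 QD2 : ℝ}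
    (h23 : ∑ x ∈ finsetOf (PsiOne χ), ∑ ρ ∈ finsetOf (zeroSet D x),
      ‖x.ψ.LFunction (ρ + beta1 c' D) / deriv x.ψ.LFunction ρ‖ *
        ‖x.ψ.LFunction (ρ + beta2 c' D) * x.ψ.LFunction (ρ + beta3 c' D)‖ ^ 2 * ‖omegaW D ρ‖ ≤ Q23)
    (hB : ∑ x ∈ finsetOf (PsiOne χ), ∑ ρ ∈ finsetOf (zeroSet D x),
      ‖x.ψ.LFunction (ρ + beta1 c' D) / deriv x.ψ.LFunction ρ‖ * ‖Bpoly χ x ρ‖ ^ 2 * ‖omegaW D ρ‖ ≤ QB)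
    (hL2 : ∑ x ∈ finsetOf (PsiOne χ), ∑ ρ ∈ finsetOf (zeroSet D x),
      ‖x.ψ.LFunction (ρ + beta1 c' D) / deriv x.ψ.LFunction ρ‖ *
        ‖x.ψ.LFunction (ρ + beta2 c' D)‖ ^ 2 * ‖omegaW D ρ‖ ≤ QL2)
    (hN3B : ∑ x ∈ finsetOf (PsiOne χ), ∑ ρ ∈ finsetOf (zeroSet D x),
      ‖x.ψ.LFunction (ρ + beta1 c' D) / deriv x.ψ.LFunction ρ‖ *
        ‖Nchar D (psiFn x) (ρ + beta3 c' D) * Bpoly χ x ρ‖ ^ 2 * ‖omegaW D ρ‖ ≤ QN3B)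
    (hN3 : ∑ x ∈ finsetOf (PsiOne χ), ∑ ρ ∈ finsetOf (zeroSet D x),
      ‖x.ψ.LFunction (ρ + beta1 c' D) / deriv x.ψ.LFunction ρ‖ *
        ‖Nchar D (psiFn x) (ρ + beta3 c' D)‖ ^ 2 * ‖omegaW D ρ‖ ≤ QN3)
    (hN2B : ∑ x ∈ finsetOf (PsiOne χ), ∑ ρ ∈ finsetOf (zeroSet D x),
      ‖x.ψ.LFunction (ρ + beta1 c' D) / deriv x.ψ.LFunction ρ‖ *
        ‖Nchar D (psiFn x) (ρ + beta2 c' D) * Bpoly χ x ρ‖ ^ 2 * ‖omegaW D ρ‖ ≤ QN2B)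
    (hD3 : ∀ v : ℝ, |v| ≤ ell D ^ 20 → ∑ x ∈ finsetOf (PsiOne χ), ∑ ρ ∈ finsetOf (zeroSet D x),
      ‖x.ψ.LFunction (ρ + beta1 c' D) / deriv x.ψ.LFunction ρ‖ *
        ‖(∑ n ∈ Finset.Ico 1 ⌈bigT D ^ 3⌉₊, x.ψ (n : ZMod x.p) * (n : ℂ) ^ (-(ρ + beta3 c' D + v * I))) *
          Bpoly χ x ρ‖ ^ 2 * ‖omegaW D ρ‖ ≤ QD3)
    (hD2 : ∀ v : ℝ, |v| ≤ ell D ^ 20 → ∑ x ∈ finsetOf (PsiOne χ), ∑ ρ ∈ finsetOf (zeroSet D x),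
      ‖x.ψ.LFunction (ρ + beta1 c' D) / deriv x.ψ.LFunction ρ‖ *
        ‖(∑ n ∈ Finset.Ico 1 ⌈bigT D ^ 3⌉₊, x.ψ (n : ZMod x.p) * (n : ℂ) ^ (-(ρ + beta2 c' D + v * I))) *
          Bpoly χ x ρ‖ ^ 2 * ‖omegaW D ρ‖ ≤ QD2) :
    frakE c' c₀ χ ≤
      (t0 D)⁻¹ * (Real.sqrt Q23 * Real.sqrt QB) +
      (ell D ^ 123)⁻¹ * (Real.sqrt QL2 * Real.sqrt QN3B + Real.sqrt QN3 * Real.sqrt QN2B) +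
      (ell D ^ 68)⁻¹ * (2 * Real.sqrt π * ell D ^ 15) *
        (Real.sqrt QL2 * Real.sqrt QD3 + Real.sqrt QN3 * Real.sqrt QD2) +
      Real.exp (-c₀ * ell D ^ 10) * (Real.sqrt QL2 * Real.sqrt QB + Real.sqrt QN3 * Real.sqrt QB) := by
  -- abbreviations, per index `i = ⟨ψ, ρ⟩`
  set Sx := idx χ with hSx
  set w : ((_ : Chr D) × ℂ) → ℝ := fun i =>
    ‖i.1.ψ.LFunction (i.2 + beta1 c' D) / deriv i.1.ψ.LFunction i.2‖ * ‖omegaW D i.2‖ with hw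
  set l2 : ((_ : Chr D) × ℂ) → ℝ := fun i => ‖i.1.ψ.LFunction (i.2 + beta2 c' D)‖ with hl2
  set l23 : ((_ : Chr D) × ℂ) → ℝ := fun i =>
    ‖i.1.ψ.LFunction (i.2 + beta2 c' D) * i.1.ψ.LFunction (i.2 + beta3 c' D)‖ with hl23
  set n3 : ((_ : Chr D) × ℂ) → ℝ := fun i => ‖Nchar D (psiFn i.1) (i.2 + beta3 c' D)‖ with hn3
  set b : ((_ : Chr D) × ℂ) → ℝ := fun i => ‖Bpoly χ i.1 i.2‖ with hb
  set n3b : ((_ : Chr D) × ℂ) → ℝ := fun i =>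
    ‖Nchar D (psiFn i.1) (i.2 + beta3 c' D) * Bpoly χ i.1 i.2‖ with hn3b
  set n2b : ((_ : Chr D) × ℂ) → ℝ := fun i =>
    ‖Nchar D (psiFn i.1) (i.2 + beta2 c' D) * Bpoly χ i.1 i.2‖ with hn2b
  have hw0 : ∀ i ∈ Sx, 0 ≤ w i := fun i _ => mul_nonneg (norm_nonneg _) (norm_nonneg _)
  have hnn : ∀ (f : ((_ : Chr D) × ℂ) → ℂ), ∀ i ∈ Sx, 0 ≤ ‖f i‖ := fun f i _ => norm_nonneg _
  -- the double sums as sums over `idx χ`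
  have hsig : ∀ F : ((_ : Chr D) × ℂ) → ℝ,
      ∑ x ∈ finsetOf (PsiOne χ), ∑ ρ ∈ finsetOf (zeroSet D x), F ⟨x, ρ⟩ = ∑ i ∈ Sx, F i := by
    intro F; rw [hSx, idx, Finset.sum_sigma]
  -- the eight zero-sum bounds, over `idx χ`, in the shape `Σ w·a²`
  have q23 : ∑ i ∈ Sx, w i * l23 i ^ 2 ≤ Q23 := by
    rw [← hsig]; refine le_of_eq_of_le (Finset.sum_congr rfl fun x _ => Finset.sum_congr rfl
      fun ρ _ => ?_) h23; simp only [hw, hl23]; ring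
  have qB : ∑ i ∈ Sx, w i * b i ^ 2 ≤ QB := by
    rw [← hsig]; refine le_of_eq_of_le (Finset.sum_congr rfl fun x _ => Finset.sum_congr rfl
      fun ρ _ => ?_) hB; simp only [hw, hb]; ring
  have qL2 : ∑ i ∈ Sx, w i * l2 i ^ 2 ≤ QL2 := by
    rw [← hsig]; refine le_of_eq_of_le (Finset.sum_congr rfl fun x _ => Finset.sum_congr rfl
      fun ρ _ => ?_) hL2; simp only [hw, hl2]; ring
  have qN3B : ∑ i ∈ Sx, w i * n3b i ^ 2 ≤ QN3B := by
    rw [← hsig]; refine le_of_eq_of_le (Finset.sum_congr rfl fun x _ => Finset.sum_congr rfl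
      fun ρ _ => ?_) hN3B; simp only [hw, hn3b]; ring
  have qN3 : ∑ i ∈ Sx, w i * n3 i ^ 2 ≤ QN3 := by
    rw [← hsig]; refine le_of_eq_of_le (Finset.sum_congr rfl fun x _ => Finset.sum_congr rfl
      fun ρ _ => ?_) hN3; simp only [hw, hn3]; ring
  have qN2B : ∑ i ∈ Sx, w i * n2b i ^ 2 ≤ QN2B := by
    rw [← hsig]; refine le_of_eq_of_le (Finset.sum_congr rfl fun x _ => Finset.sum_congr rfl
      fun ρ _ => ?_) hN2B; simp only [hw, hn2b]; ring
  have qD3 : ∀ v : ℝ, |v| ≤ ell D ^ 20 → ∑ i ∈ Sx, w i * (b i * ‖∑ n ∈ Finset.Ico 1 ⌈bigT D ^ 3⌉₊,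
      (i.1).ψ (n : ZMod (i.1).p) * (n : ℂ) ^ (-(i.2 + beta3 c' D + v * I))‖) ^ 2 ≤ QD3 := by
    intro v hv
    rw [← hsig]; refine le_of_eq_of_le (Finset.sum_congr rfl fun x _ => Finset.sum_congr rfl
      fun ρ _ => ?_) (hD3 v hv); simp only [hw, hb, norm_mul]; ring
  have qD2 : ∀ v : ℝ, |v| ≤ ell D ^ 20 → ∑ i ∈ Sx, w i * (b i * ‖∑ n ∈ Finset.Ico 1 ⌈bigT D ^ 3⌉₊,
      (i.1).ψ (n : ZMod (i.1).p) * (n : ℂ) ^ (-(i.2 + beta2 c' D + v * I))‖) ^ 2 ≤ QD2 := by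
    intro v hv
    rw [← hsig]; refine le_of_eq_of_le (Finset.sum_congr rfl fun x _ => Finset.sum_congr rfl
      fun ρ _ => ?_) (hD2 v hv); simp only [hw, hb, norm_mul]; ring
  -- the seven Cauchy–Schwarz steps
  have s1 : ∑ i ∈ Sx, w i * l23 i * b i ≤ Real.sqrt Q23 * Real.sqrt QB :=
    weighted_cauchy_schwarz Sx hw0 (fun i _ => norm_nonneg _) (fun i _ => norm_nonneg _) q23 qB
  have s2 : ∑ i ∈ Sx, w i * l2 i * n3b i ≤ Real.sqrt QL2 * Real.sqrt QN3B :=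
    weighted_cauchy_schwarz Sx hw0 (fun i _ => norm_nonneg _) (fun i _ => norm_nonneg _) qL2 qN3B
  have s3 : ∑ i ∈ Sx, w i * l2 i * b i * E1main i.1 (i.2 + beta3 c' D) ≤
      (ell D ^ 68)⁻¹ * (2 * Real.sqrt π * ell D ^ 15) * (Real.sqrt QL2 * Real.sqrt QD3) :=
    weighted_sum_E1main_le Sx hℓ (fun i => i.1) (fun i => i.2 + beta3 c' D) hw0
      (fun i _ => norm_nonneg _) (fun i _ => norm_nonneg _) qL2 qD3
  have s3' : ∑ i ∈ Sx, w i * l2 i * b i ≤ Real.sqrt QL2 * Real.sqrt QB :=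
    weighted_cauchy_schwarz Sx hw0 (fun i _ => norm_nonneg _) (fun i _ => norm_nonneg _) qL2 qB
  have s4 : ∑ i ∈ Sx, w i * n3 i * n2b i ≤ Real.sqrt QN3 * Real.sqrt QN2B :=
    weighted_cauchy_schwarz Sx hw0 (fun i _ => norm_nonneg _) (fun i _ => norm_nonneg _) qN3 qN2B
  have s5 : ∑ i ∈ Sx, w i * n3 i * b i * E1main i.1 (i.2 + beta2 c' D) ≤
      (ell D ^ 68)⁻¹ * (2 * Real.sqrt π * ell D ^ 15) * (Real.sqrt QN3 * Real.sqrt QD2) :=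
    weighted_sum_E1main_le Sx hℓ (fun i => i.1) (fun i => i.2 + beta2 c' D) hw0
      (fun i _ => norm_nonneg _) (fun i _ => norm_nonneg _) qN3 qD2
  have s5' : ∑ i ∈ Sx, w i * n3 i * b i ≤ Real.sqrt QN3 * Real.sqrt QB :=
    weighted_cauchy_schwarz Sx hw0 (fun i _ => norm_nonneg _) (fun i _ => norm_nonneg _) qN3 qB
  -- assemble
  have ht0 : 0 ≤ (t0 D)⁻¹ := inv_nonneg.mpr (by unfold t0; positivity)
  have h123 : 0 ≤ (ell D ^ 123)⁻¹ := by positivity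
  have hε : 0 ≤ Real.exp (-c₀ * ell D ^ 10) := (Real.exp_pos _).le
  rw [frakE_eq_seven c' c₀ χ]
  have e1 := mul_le_mul_of_nonneg_left s1 ht0
  have e2 := mul_le_mul_of_nonneg_left s2 h123
  have e3' := mul_le_mul_of_nonneg_left s3' hε
  have e4 := mul_le_mul_of_nonneg_left s4 h123
  have e5' := mul_le_mul_of_nonneg_left s5' hε
  simp only [hw, hl2, hl23, hn3, hb, hn3b, hn2b] at e1 e2 s3 e3' e4 s5 e5'
  linarith [e1, e2, s3, e3', e4, s5, e5']

end Literature.NumberTheory.LFunctions.Zhang2022.Typed.Section13
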